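import Summits.BirchSwinnertonDyer.BirchSwinnertonDyer.Theses.ByReductionTypeAtTwo
import Literature.NumberTheory.EllipticCurves.BSDSelmerSkinnerProofs
import HarnessLib

/-!
# Route `ByReductionTypeAtTwo`, layer-2 child `MultLowerHalfAtTwo` (item stmt-BirchSwinnertonDyer-19923):
# the SHAPE of the item — idle binder, core range, split/non-split halves

Seat bsd-2adic-mult-3 GEN 4 (D-0074 (A) row «find: 19923 MultLowerHalfAtTwo»). The ∀-statement
`MultLowerHalfAtTwo` (`∀ W` non-CM, analytic rank `0`, multiplicative at `2`: `ord₂ #Ш_an ≤ ord₂ #Ш`,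
`Typed.MissingLowerBoundAt W 2`) is the Eisenstein direction of the `2`-adic cyclotomic main
conjecture at a multiplicative `2` (typed T-mult-4-int `X5.O1.MultEisensteinDivisibilityAtTwo`,
p417443; bridges p418911/p428384): not in print at `p = 2` and not settled here. This file records,
as kernel theorems with the FULLY-QUALIFIED route decls, three structural facts about the item that
the planner / tribunal / disprover use when reading it:

* §1 **the `¬ W.HasCM` binder is idle** on the whole multiplicative block (items 19923, 19922, 19096):
  a curve with multiplicative reduction at any prime has non-integral `j`, hence no CM — a THEOREM
  of the tree (`not_hasCM_of_hasMultiplicativeReductionAtPrime'`, Silverman AEC VII.5.1(b) + ATAEC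
  II.6.1, unconditional). So each of the three route decls is equivalent to its `¬CM`-free form.
* §2 **the core range**: the item is equivalent to its restriction to curves whose analytic order of
  `Ш` has POSITIVE `2`-adic valuation (`∀ q, shaAn W = q → 0 < ord₂ q`); the instances with
  `ord₂ #Ш_an ≤ 0` are free (`⟨q, hq, _⟩`, no input). This is exactly why the printed `p = 2`
  results for quadratic-twist families of curves multiplicative at `2` (Zhai 2016 Thms 1.1–1.5;
  Cai–Li–Zhai 2019 Thms 1.1/1.5, Rem. 1.8: `X₀(14)` non-split, `34A1` split; Shu–Zhai 2021;
  Kriz–Li 2019), all of which have `Ш[2^∞]_an` trivial, are DEGENERATE instances of this item and do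
  not bear on its content (`ord₂ #Ш_an ≥ 4` on every book230 X5 class).
* §3 **split / non-split halves**: the item is the conjunction of its non-split half (after conv-2's
  Thm-1.5 upgrade: PRINT + T-mult-4-int only) and its split half (which alone carries the MEMO input
  Greenberg–Stevens at `2`); stated binder-free (no new `def`), both directions.

HONEST FRAMING (cell bsd-2adic): bookkeeping equivalences; nothing asserted; the item stays OPEN;
no class is closed; BSD is not proved by any of this. PARTITION: X5@2 mult (K4ᵐ, RESIDUAL-MAP B1·O1;
1 976 book230 classes) × p = 2 — types-the-object-of (item 19923: statement shape); closes none.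
[cite: SilvermanAEC2009, Prop. VII.5.1(b)] [cite: SilvermanATAEC1994, Thm. II.6.1]
[cite: Miller2011LMS, Def. 1.1] [cite: CaiLiZhai2019, Thm. 1.5 and Rem. 1.8 (arXiv:1712.01271 p. 2)]
[cite: Zhai2016, Thms. 1.1–1.5 (arXiv:1409.0231 pp. 1–4)]
-/

set_option autoImplicit false
-- the route's Theorems namespace repeats a component by design (summit = sub-problem, D-0017).
set_option linter.dupNamespace false

noncomputable section

open scoped Classical

open WeierstrassCurve Literature.NumberTheory.EllipticCurves
  Literature.NumberTheory.EllipticCurves.Rank1Residual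
  Literature.NumberTheory.EllipticCurves.Rank1Residual.Typed

namespace Summit.BirchSwinnertonDyer.BirchSwinnertonDyer.Theorems

/-! ## §1 The `¬CM` binder is idle on the multiplicative block -/

/-- **Item 19923 without the idle binder.** `MultLowerHalfAtTwo` is equivalent to the same
statement with `¬ W.HasCM` dropped: multiplicative reduction at `2` already excludes CM
(`not_hasCM_of_hasMultiplicativeReductionAtPrime'`, a theorem of the tree). Bookkeeping.
[cite: SilvermanAEC2009, Prop. VII.5.1(b)] [cite: SilvermanATAEC1994, Thm. II.6.1] -/
theorem multLowerHalfAtTwo_iff_cmFree :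
    Summit.BirchSwinnertonDyer.BirchSwinnertonDyer.Theses.ByReductionTypeAtTwo.MultLowerHalfAtTwo ↔
      ∀ (W : WeierstrassCurve ℚ) [W.IsElliptic] [W.IsGloballyMinimal],
        W.analyticRank = 0 → Mult W 2 → MissingLowerBoundAt W 2 := by
  unfold Summit.BirchSwinnertonDyer.BirchSwinnertonDyer.Theses.ByReductionTypeAtTwo.MultLowerHalfAtTwo
  constructor
  · intro h W _ _ hr hmult
    exact h W (not_hasCM_of_hasMultiplicativeReductionAtPrime' W hmult) hr hmult
  · intro h W _ _ _ hr hmult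
    exact h W hr hmult

/-- **Item 19922 without the idle binder.** `MultUpperHalfAtTwo` is equivalent to the same
statement with `¬ W.HasCM` dropped (same reason). Bookkeeping.
[cite: SilvermanAEC2009, Prop. VII.5.1(b)] [cite: SilvermanATAEC1994, Thm. II.6.1] -/
theorem multUpperHalfAtTwo_iff_cmFree :
    Summit.BirchSwinnertonDyer.BirchSwinnertonDyer.Theses.ByReductionTypeAtTwo.MultUpperHalfAtTwo ↔
      ∀ (W : WeierstrassCurve ℚ) [W.IsElliptic] [W.IsGloballyMinimal],
        W.analyticRank = 0 → Mult W 2 → MissingUpperBoundAt W 2 := by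
  unfold Summit.BirchSwinnertonDyer.BirchSwinnertonDyer.Theses.ByReductionTypeAtTwo.MultUpperHalfAtTwo
  constructor
  · intro h W _ _ hr hmult
    exact h W (not_hasCM_of_hasMultiplicativeReductionAtPrime' W hmult) hr hmult
  · intro h W _ _ _ hr hmult
    exact h W hr hmult

/-- **Item 19096 (the parent) without the idle binder.** `MultiplicativeRankZeroAtTwo` is equivalent
to the same statement with `¬ W.HasCM` dropped (same reason). Bookkeeping.
[cite: SilvermanAEC2009, Prop. VII.5.1(b)] [cite: SilvermanATAEC1994, Thm. II.6.1] -/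
theorem multiplicativeRankZeroAtTwo_iff_cmFree :
    Summit.BirchSwinnertonDyer.BirchSwinnertonDyer.Theses.ByReductionTypeAtTwo.MultiplicativeRankZeroAtTwo ↔
      ∀ (W : WeierstrassCurve ℚ) [W.IsElliptic] [W.IsGloballyMinimal],
        W.analyticRank = 0 → Mult W 2 → BSDp W 2 := by
  unfold
    Summit.BirchSwinnertonDyer.BirchSwinnertonDyer.Theses.ByReductionTypeAtTwo.MultiplicativeRankZeroAtTwo
  constructor
  · intro h W _ _ hr hmult
    exact h W (not_hasCM_of_hasMultiplicativeReductionAtPrime' W hmult) hr hmult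
  · intro h W _ _ _ hr hmult
    exact h W hr hmult

/-! ## §2 The core range: `ord₂ #Ш_an > 0` -/

/-- **Item 19923 is its own restriction to `ord₂ #Ш_an > 0`.** `MultLowerHalfAtTwo` is equivalent to
the statement on curves (multiplicative at `2`, analytic rank `0`) whose analytic order of `Ш` has
positive `2`-adic valuation whenever it is rational: the instances with `shaAn W = q`, `ord₂ q ≤ 0`
hold with no input at all (`0 ≤ ord₂ #Ш(E)`), and no rationality hypothesis is needed for the
equivalence (classical case split). Hence every printed `p = 2` instance with `#Ш_an` odd is
degenerate for this item. Bookkeeping. [cite: Miller2011LMS, Def. 1.1]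
[cite: CaiLiZhai2019, Thm. 1.5 and Rem. 1.8 (arXiv:1712.01271 p. 2)] -/
theorem multLowerHalfAtTwo_iff_core :
    Summit.BirchSwinnertonDyer.BirchSwinnertonDyer.Theses.ByReductionTypeAtTwo.MultLowerHalfAtTwo ↔
      ∀ (W : WeierstrassCurve ℚ) [W.IsElliptic] [W.IsGloballyMinimal],
        W.analyticRank = 0 → Mult W 2 → (∀ q : ℚ, shaAn W = (q : ℂ) → 0 < padicValRat 2 q) →
          MissingLowerBoundAt W 2 := by
  rw [multLowerHalfAtTwo_iff_cmFree]
  constructor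
  · intro h W _ _ hr hmult _
    exact h W hr hmult
  · intro h W _ _ hr hmult
    by_cases hq : ∃ q : ℚ, shaAn W = (q : ℂ) ∧ padicValRat 2 q ≤ 0
    · obtain ⟨q, hq, hv⟩ := hq
      exact ⟨q, hq, hv.trans (by positivity)⟩
    · push Not at hq
      exact h W hr hmult hq

/-! ## §3 Split / non-split halves (binder-free) -/

/-- **The two halves give the item.** The non-split half (multiplicative at `2`, not split) and the
split half (split multiplicative at `2`) of the lower bound, each ∀-closed over analytic rank `0`,
give `MultLowerHalfAtTwo` (the `¬CM` binder being idle, §1). After the cotorsion upgrade (Greenberg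
LNM 1716 Thm. 1.5, conv-2 GEN 4) the non-split half rests on PRINT + T-mult-4-int only; the split
half alone carries the MEMO input Greenberg–Stevens at `2`. Bookkeeping.
[cite: GreenbergLNM1716, Thm. 1.5 (p. 61) and §4 pp. 112–113] -/
theorem multLowerHalfAtTwo_of_nonsplit_of_split
    (hns : ∀ (W : WeierstrassCurve ℚ) [W.IsElliptic] [W.IsGloballyMinimal],
      W.analyticRank = 0 → Mult W 2 → ¬ W.HasSplitMultiplicativeReductionAtPrime 2 →
        MissingLowerBoundAt W 2)
    (hsp : ∀ (W : WeierstrassCurve ℚ) [W.IsElliptic] [W.IsGloballyMinimal],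
      W.analyticRank = 0 → Mult W 2 → W.HasSplitMultiplicativeReductionAtPrime 2 →
        MissingLowerBoundAt W 2) :
    Summit.BirchSwinnertonDyer.BirchSwinnertonDyer.Theses.ByReductionTypeAtTwo.MultLowerHalfAtTwo := by
  rw [multLowerHalfAtTwo_iff_cmFree]
  intro W _ _ hr hmult
  by_cases hs : W.HasSplitMultiplicativeReductionAtPrime 2
  · exact hsp W hr hmult hs
  · exact hns W hr hmult hs

/-- **The item gives its non-split half.** Bookkeeping (projection).
[cite: GreenbergLNM1716, §4 pp. 112–113] -/
theorem multLowerHalfAtTwo_nonsplit_of_multLowerHalfAtTwo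
    (h : Summit.BirchSwinnertonDyer.BirchSwinnertonDyer.Theses.ByReductionTypeAtTwo.MultLowerHalfAtTwo) :
    ∀ (W : WeierstrassCurve ℚ) [W.IsElliptic] [W.IsGloballyMinimal],
      W.analyticRank = 0 → Mult W 2 → ¬ W.HasSplitMultiplicativeReductionAtPrime 2 →
        MissingLowerBoundAt W 2 := by
  rw [multLowerHalfAtTwo_iff_cmFree] at h
  intro W _ _ hr hmult _
  exact h W hr hmult

/-- **The item gives its split half.** Bookkeeping (projection).
[cite: GreenbergLNM1716, §4 pp. 112–113] -/
theorem multLowerHalfAtTwo_split_of_multLowerHalfAtTwo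
    (h : Summit.BirchSwinnertonDyer.BirchSwinnertonDyer.Theses.ByReductionTypeAtTwo.MultLowerHalfAtTwo) :
    ∀ (W : WeierstrassCurve ℚ) [W.IsElliptic] [W.IsGloballyMinimal],
      W.analyticRank = 0 → Mult W 2 → W.HasSplitMultiplicativeReductionAtPrime 2 →
        MissingLowerBoundAt W 2 := by
  rw [multLowerHalfAtTwo_iff_cmFree] at h
  intro W _ _ hr hmult _
  exact h W hr hmult

end Summit.BirchSwinnertonDyer.BirchSwinnertonDyer.Theorems

end
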